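import Summits.BirchSwinnertonDyer.BirchSwinnertonDyer.Theorems.AdditiveKolyvaginRoadRamifiedHabitatPStarTwistLocal
import Literature.NumberTheory.EllipticCurves.CuspFormLFunctionNewformFrickeProofs
import Literature.NumberTheory.EllipticCurves.AtkinLehnerInvolutionsNewformProofs
import Literature.NumberTheory.EllipticCurves.BSDConductor
import Literature.NumberTheory.EllipticCurves.TwistRootNumberModularityProofs
import HarnessLib

/-!
# Route `AdditiveKolyvaginRoad`, crux KS′ `LevelKolyvaginSystemsAdditive` (stmt-BirchSwinnertonDyer-21396), card `ramified-toric-habitat` —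
# part 2: the `p*`-TWIST SIGN RATIO `w(E)·w(E^{(p*)})` at an additive potentially good prime `p ≥ 5` (types II, III, IV)

Cell `pub/bsd-wall`, width seat `bsd-wall-akr-p2x-w2` g11; `--supports stmt-BirchSwinnertonDyer-21396` (helper). THEOREMS ONLY; no definition,
no named fact, no `sorry`. BSD is not proved by any of this; KS′/KPA′ stay OPEN at `p² ∣ N`.

For `E/ℚ` of conductor `N = M·p²` with `M` squarefree and prime to `p` (semistable away from `p`) and `E' = E^{(p*)}`,
`p* = (−1)^{(p−1)/2} p`:

* §3 `rootNumber_mul_rootNumber_pStarTwist_eq_legendreSym_mul` — **Atkin–Lehner-formal part, from `IsNewformOf` data alone**: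
  `w(E)·w(E') = (M/p)·λ_p(f)·λ_p(f')` for the newforms `f, f'` of `E, E'` when `N_{E'} = N_E`. Ingredients, all theorems of the tree:
  `w = −ε(f)` (Hecke), `ε(f) = ∏_{q ∣ N} λ_q(f)` (Knapp Thm. 9.27(c)), `λ_q = −a_q` at `q ∥ N` (Thm. 9.27), `a_q(E') = (q/p)·a_q(E)`
  (`LFunction_quadraticTwist_pStar_apply`), `λ_q = ±1`; so `λ_q(f)λ_q(f') = (q/p)` at `q ∣ M` and `∏_{q ∣ M} (q/p) = (M/p)`.
  The eigenvalues AT `p` stay symbolic: they are NOT Atkin–Lehner-formal (at `p = 7`, `d = −119` the card's PARI table has opposite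
  signs for `e = 6` and `e = 4` at equal `(M/p)`), which is where a local-global input is unavoidable.
* §4 `rootNumber_mul_rootNumber_pStarTwist` — **explicit**, CONDITIONAL on the Modularity Theorem (`exists_isNewformOf`) and on
  Kellock–Dokchitser's Remark 2.2 `λ(Q_p) = W_p` for `E` and `E'` (the tree's named fact `atkinLehnerEigenvalueAt_eq_localRootNumberAt`,
  used only at `p`): if the minimal model of `E` at `p` has `ord_p Δ = a ∈ {2,3,4}`, `ord_p c₄ > 0`, `3 ord_p c₄ ≥ ord_p Δ`, then
  `w(E)·w(E') = (M/p)·(3/p)` for `a ∈ {2, 4}` (`e ∈ {6, 3}`) and `= (M/p)` for `a = 3` (`e = 4`) — by part 1.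

Part 3 (`…RamifiedHabitatSignLaw`) turns this into the card's habitat sign law. No new definitions, no new named facts.

References: [cite: Knapp1993, Thm. 9.27] [cite: AtkinLehner1970, Thm. 3 and §6] [cite: KellockDokchitser2023, Rem. 2.2]
[cite: Rohrlich1993Compositio, Prop. 2(iv)].
-/

set_option autoImplicit false
set_option linter.dupNamespace false

noncomputable section

open scoped Classical MatrixGroups

open CongruenceSubgroup IsDedekindDomain IsDedekindDomain.HeightOneSpectrum NumberField Rat.HeightOneSpectrum
  WeierstrassCurve Literature.NumberTheory.EllipticCurves Literature.NumberTheory.EllipticCurves.ModularForms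
  IsDiscreteValuationRing

namespace Summit.BirchSwinnertonDyer.BirchSwinnertonDyer.Theorems.AdditiveKoly.RamifiedHabitat

/-! ## §3 The modular assembly: `w(E)·w(E^{(p*)}) = (M/p)·λ_p(f)·λ_p(f')` from Atkin–Lehner theory alone -/

section Modular

variable {p : ℕ} [Fact p.Prime]

/-- **`w(E)·w(E') = (M/p)·λ_p(f)·λ_p(f')` — the `p*`-twist sign ratio is Atkin–Lehner-formal off `p`.** Let `W/ℚ` be elliptic
of conductor `N = M·p²` with `M` squarefree and `p ∤ M` (`p` an odd prime), `W' = W^{(p*)}` elliptic of the SAME conductor,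
`f, f'` their newforms (`IsNewformOf`). Then `w(W) = −ε(f) = −∏_{q ∣ N} λ_q(f)` (Hecke + Atkin–Lehner, Knapp Thm. 9.27(c)),
likewise for `W'`; at `q ∥ N` (`q ∣ M`) Knapp's `λ_q = −a_q` (Thm. 9.27) and `a_q(W') = (q/p)·a_q(W)`
(`LFunction_quadraticTwist_pStar_apply`) give `λ_q(f)λ_q(f') = (q/p)·λ_q(f)² = (q/p)`, and `∏_{q ∣ M}(q/p) = (M/p)` for squarefree
`M`. No local-global input is used: the two eigenvalues AT `p` stay symbolic. [cite: Knapp1993, Thm. 9.27] [cite: AtkinLehner1970, Thm. 3 and §6] -/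
theorem rootNumber_mul_rootNumber_pStarTwist_eq_legendreSym_mul (W : WeierstrassCurve ℚ) [W.IsElliptic]
    [NeZero (W.conductorNorm ℤ)] (hp2 : p ≠ 2) {M : ℕ} (hN : W.conductorNorm ℤ = M * p ^ 2) (hM : Squarefree M)
    (hpM : ¬ p ∣ M) [(W.quadraticTwist (((-1 : ℤ) ^ (p / 2) * p : ℤ) : ℚ)).IsElliptic]
    [NeZero ((W.quadraticTwist (((-1 : ℤ) ^ (p / 2) * p : ℤ) : ℚ)).conductorNorm ℤ)]
    (hN' : (W.quadraticTwist (((-1 : ℤ) ^ (p / 2) * p : ℤ) : ℚ)).conductorNorm ℤ = M * p ^ 2)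
    {f : CuspForm (Gamma0 (W.conductorNorm ℤ)) 2} (hf : IsNewformOf W f)
    {f' : CuspForm (Gamma0 ((W.quadraticTwist (((-1 : ℤ) ^ (p / 2) * p : ℤ) : ℚ)).conductorNorm ℤ)) 2}
    (hf' : IsNewformOf (W.quadraticTwist (((-1 : ℤ) ^ (p / 2) * p : ℤ) : ℚ)) f') :
    ((W.rootNumber * (W.quadraticTwist (((-1 : ℤ) ^ (p / 2) * p : ℤ) : ℚ)).rootNumber : ℤ) : ℂ) =
      legendreSym p M * (atkinLehnerEigenvalueAt f p * atkinLehnerEigenvalueAt f' p) := by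
  have hp : p.Prime := Fact.out
  -- `w = -ε(f) = -∏ λ_q(f)` for both curves
  have hw : (W.rootNumber : ℂ) = -frickeEigenvalue f :=
    Literature.NumberTheory.EllipticCurves.rootNumber_eq_neg_of_frickeInvolution_eq_smul W hf
      (IsNewform0.frickeEigenvalue_eq_one_or_eq_neg_one_holds hf.1) (IsNewform0.frickeInvolution_eq_smul_holds hf.1)
  have hw' : ((W.quadraticTwist (((-1 : ℤ) ^ (p / 2) * p : ℤ) : ℚ)).rootNumber : ℂ) = -frickeEigenvalue f' :=
    Literature.NumberTheory.EllipticCurves.rootNumber_eq_neg_of_frickeInvolution_eq_smul _ hf'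
      (IsNewform0.frickeEigenvalue_eq_one_or_eq_neg_one_holds hf'.1) (IsNewform0.frickeInvolution_eq_smul_holds hf'.1)
  have hε := IsNewform0.frickeEigenvalue_eq_prod_atkinLehnerEigenvalueAt_holds hf.1
  have hε' := IsNewform0.frickeEigenvalue_eq_prod_atkinLehnerEigenvalueAt_holds hf'.1
  -- the prime factors of the common level `M p²`
  have hM0 : M ≠ 0 := hM.ne_zero
  have hpf0 : (M * p ^ 2).primeFactors = insert p M.primeFactors := by
    rw [Nat.primeFactors_mul hM0 (pow_ne_zero 2 hp.ne_zero), Nat.primeFactors_pow _ two_ne_zero,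
      hp.primeFactors, Finset.union_comm]
    rfl
  have hpf : (W.conductorNorm ℤ).primeFactors = insert p M.primeFactors := by rw [hN, hpf0]
  have hpf' : ((W.quadraticTwist (((-1 : ℤ) ^ (p / 2) * p : ℤ) : ℚ)).conductorNorm ℤ).primeFactors =
      insert p M.primeFactors := by rw [hN', hpf0]
  have hpnot : p ∉ M.primeFactors := fun h ↦ hpM (Nat.dvd_of_mem_primeFactors h)
  -- at `q ∣ M`: `λ_q(f) λ_q(f') = (q/p)`
  have hq : ∀ q ∈ M.primeFactors, atkinLehnerEigenvalueAt f q * atkinLehnerEigenvalueAt f' q = legendreSym p q := by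
    intro q hqM
    have hqp : q.Prime := Nat.prime_of_mem_primeFactors hqM
    haveI := Fact.mk hqp
    have hqdM : q ∣ M := Nat.dvd_of_mem_primeFactors hqM
    have hqnep : q ≠ p := fun h ↦ hpnot (h ▸ hqM)
    have hpq : ¬ p ∣ q := fun h ↦ hqnep ((Nat.prime_dvd_prime_iff_eq hp hqp).mp h).symm
    -- `N = q · (M/q · p²)` with `q ∤ M/q · p²`
    obtain ⟨M₁, hM₁⟩ := hqdM
    have hqM₁ : ¬ q ∣ M₁ := by
      rintro ⟨M₂, rfl⟩
      exact hqp.one_lt.ne' (Nat.isUnit_iff.mp (hM q ⟨M₂, by rw [hM₁]; ring⟩))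
    have hqrest : ¬ q ∣ M₁ * p ^ 2 := by
      intro h
      rcases (Nat.Prime.dvd_mul hqp).mp h with h | h
      · exact hqM₁ h
      · exact hqnep ((Nat.prime_dvd_prime_iff_eq hqp hp).mp (hqp.dvd_of_dvd_pow h))
    have hNq : W.conductorNorm ℤ = q * (M₁ * p ^ 2) := by rw [hN, hM₁]; ring
    have hNq' : (W.quadraticTwist (((-1 : ℤ) ^ (p / 2) * p : ℤ) : ℚ)).conductorNorm ℤ = q * (M₁ * p ^ 2) := by
      rw [hN', hM₁]; ring
    have h1 : atkinLehnerEigenvalueAt f q = -cuspCoeff f q :=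
      hf.1.atkinLehnerEigenvalueAt_eq_neg_coeff_of_not_dvd q hNq hqrest
    have h2 : atkinLehnerEigenvalueAt f' q = -cuspCoeff f' q :=
      hf'.1.atkinLehnerEigenvalueAt_eq_neg_coeff_of_not_dvd q hNq' hqrest
    have h3 : cuspCoeff f' q = legendreSym p q * cuspCoeff f q := by
      rw [hf.2 q, hf'.2 q, W.LFunction_quadraticTwist_pStar_apply hp2 hpq]
      push_cast
      ring
    have h1' : cuspCoeff f q = -atkinLehnerEigenvalueAt f q := by rw [h1, neg_neg]
    have h4 : atkinLehnerEigenvalueAt f q * atkinLehnerEigenvalueAt f q = 1 := by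
      rcases hf.1.atkinLehnerEigenvalueAt_eq_one_or_eq_neg_one hqp (hNq ▸ dvd_mul_right q _) with h | h <;>
        rw [h] <;> norm_num
    calc atkinLehnerEigenvalueAt f q * atkinLehnerEigenvalueAt f' q
        = legendreSym p q * (atkinLehnerEigenvalueAt f q * atkinLehnerEigenvalueAt f q) := by
          rw [h2, h3, h1']; ring
      _ = legendreSym p q := by rw [h4, mul_one]
  -- `∏_{q ∣ M} (q/p) = (M/p)`
  have hleg : ∏ q ∈ M.primeFactors, (legendreSym p q : ℂ) = legendreSym p M := by
    conv_rhs => rw [← Nat.prod_primeFactors_of_squarefree hM]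
    rw [Nat.cast_prod, ← legendreSym.hom_apply, map_prod]
    push_cast
    simp only [legendreSym.hom_apply]
  -- assemble
  rw [Int.cast_mul, hw, hw', hε, hε', hpf, hpf', Finset.prod_insert hpnot, Finset.prod_insert hpnot, neg_mul_neg,
    mul_mul_mul_comm, ← Finset.prod_mul_distrib, Finset.prod_congr rfl hq, hleg]
  ring

end Modular


/-! ## §4 The `p*`-twist sign ratio, explicit, modulo the Modularity Theorem and Kellock–Dokchitser's Remark 2.2 at `p` -/

section Main

variable {p : ℕ} [Fact p.Prime]

/-- **THE `p*`-TWIST SIGN RATIO AT AN ADDITIVE POTENTIALLY GOOD PRIME (types II, III, IV).** Let `W/ℚ` be elliptic of conductor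
`N = M·p²`, `p ≥ 5`, `M` squarefree and prime to `p` (so `W` is semistable away from `p`), whose minimal model at `p` has
`ord_p Δ = a ∈ {2, 3, 4}`, `ord_p c₄ > 0` and `3·ord_p c₄ ≥ ord_p Δ` (additive, potentially good: `e = 12/gcd(12, a) = 6, 4, 3`),
and let `W' = W^{(p*)}`, `p* = (−1)^{(p−1)/2} p`. ASSUMING the Modularity Theorem (`exists_isNewformOf`) and Kellock–Dokchitser's
Remark 2.2 `λ(Q_p) = W_p` for `W` and for `W'` (the tree's named fact `atkinLehnerEigenvalueAt_eq_localRootNumberAt`, deep only at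
the additive prime `p`; used only AT `p`):
`w(W)·w(W') = (M/p)·W_p(W)·W_p(W') = (M/p)·(3/p)` if `a ∈ {2, 4}` (`e ∈ {6, 3}`), `= (M/p)` if `a = 3` (`e = 4`)
(§3 + Rohrlich's case list at `p`, §1). CONDITIONAL on the two named facts; nothing else is assumed.
[cite: Rohrlich1993Compositio, Prop. 2(iv)] [cite: KellockDokchitser2023, Rem. 2.2] [cite: Knapp1993, Thm. 9.27] -/
theorem rootNumber_mul_rootNumber_pStarTwist (W : WeierstrassCurve ℚ) [W.IsElliptic] (hmod : exists_isNewformOf)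
    (hF1 : W.atkinLehnerEigenvalueAt_eq_localRootNumberAt)
    (hF1' : (W.quadraticTwist (((-1 : ℤ) ^ (p / 2) * p : ℤ) : ℚ)).atkinLehnerEigenvalueAt_eq_localRootNumberAt)
    (hp5 : 5 ≤ p) {M : ℕ} (hN : W.conductorNorm ℤ = M * p ^ 2) (hM : Squarefree M) (hpM : ¬ p ∣ M) {a : ℕ}
    (hΔ : addVal ℤ_[p] (((W.baseChange ℚ_[p]).minimal ℤ_[p]).integralModel ℤ_[p]).Δ = a)
    (ha : a = 2 ∨ a = 3 ∨ a = 4)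
    (hc₄ : addVal ℤ_[p] (((W.baseChange ℚ_[p]).minimal ℤ_[p]).integralModel ℤ_[p]).c₄ ≠ 0)
    (hj : ¬ 3 * addVal ℤ_[p] (((W.baseChange ℚ_[p]).minimal ℤ_[p]).integralModel ℤ_[p]).c₄ <
      addVal ℤ_[p] (((W.baseChange ℚ_[p]).minimal ℤ_[p]).integralModel ℤ_[p]).Δ) :
    W.rootNumber * (W.quadraticTwist (((-1 : ℤ) ^ (p / 2) * p : ℤ) : ℚ)).rootNumber =
      legendreSym p M * (if a = 3 then 1 else ZMod.χ₄ p * (if p % 3 = 1 then 1 else -1)) := by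
  have hp : p.Prime := Fact.out
  have hp2 : p ≠ 2 := by omega
  have hdZ0 : ((-1 : ℤ) ^ (p / 2) * p : ℤ) ≠ 0 :=
    mul_ne_zero (pow_ne_zero _ (by norm_num)) (by exact_mod_cast hp.ne_zero)
  have hd0 : (((((-1 : ℤ) ^ (p / 2) * p : ℤ)) : ℚ)) ≠ 0 := by exact_mod_cast hdZ0
  haveI hE' : (W.quadraticTwist (((-1 : ℤ) ^ (p / 2) * p : ℤ) : ℚ)).IsElliptic := W.isElliptic_quadraticTwist hd0
  haveI : NeZero (W.conductorNorm ℤ) := ⟨(W.conductorNorm_pos_holds).ne'⟩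
  haveI : NeZero ((W.quadraticTwist (((-1 : ℤ) ^ (p / 2) * p : ℤ) : ℚ)).conductorNorm ℤ) :=
    ⟨((W.quadraticTwist _).conductorNorm_pos_holds).ne'⟩
  -- §1: the local data at `p`; §2: the conductor of the twist
  obtain ⟨hadd, hadd', hprod⟩ := localRootNumber_mul_pStarTwist_padic W hp5 hΔ ha hc₄ hj
  have hN' : (W.quadraticTwist (((-1 : ℤ) ^ (p / 2) * p : ℤ) : ℚ)).conductorNorm ℤ = M * p ^ 2 :=
    (conductorNorm_pStarTwist_eq W hp5 hadd hadd').trans hN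
  -- §3: the modular assembly
  obtain ⟨f, hf⟩ := hmod W
  obtain ⟨f', hf'⟩ := hmod (W.quadraticTwist (((-1 : ℤ) ^ (p / 2) * p : ℤ) : ℚ))
  have h0 := rootNumber_mul_rootNumber_pStarTwist_eq_legendreSym_mul W hp2 hN hM hpM hN' hf hf'
  -- Kellock–Dokchitser at `p` for both curves, read over `ℤ_p`
  set P : Nat.Primes := ⟨p, hp⟩ with hP
  have hgen : natGenerator ((primesEquiv (R := ℤ)).symm P) = p :=
    congrArg (fun q : Nat.Primes ↦ (q : ℕ)) ((primesEquiv (R := ℤ)).apply_symm_apply P)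
  have h23 : ∀ V : WeierstrassCurve ℚ, V.HasAdditiveReductionAt ((primesEquiv (R := ℤ)).symm P) →
      3 < ringChar (ℤ ⧸ ((primesEquiv (R := ℤ)).symm P).asIdeal) := fun _ _ ↦ by
    rw [Rat.ringChar_int_quotient_asIdeal, hgen]; omega
  have hPN : (P : ℕ) ∣ W.conductorNorm ℤ := by
    change p ∣ _; rw [hN]; exact ⟨M * p, by ring⟩
  have hPN' : (P : ℕ) ∣ (W.quadraticTwist (((-1 : ℤ) ^ (p / 2) * p : ℤ) : ℚ)).conductorNorm ℤ := by
    change p ∣ _; rw [hN']; exact ⟨M * p, by ring⟩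
  have hl : atkinLehnerEigenvalueAt f p = ((W.baseChange ℚ_[p]).localRootNumber ℤ_[p] : ℂ) := by
    rw [← localRootNumberAt_primesEquiv_symm_holds W P]
    exact hF1 hf P hPN (h23 W)
  have hl' : atkinLehnerEigenvalueAt f' p =
      (((W.quadraticTwist (((-1 : ℤ) ^ (p / 2) * p : ℤ) : ℚ)).baseChange ℚ_[p]).localRootNumber ℤ_[p] : ℂ) := by
    rw [← localRootNumberAt_primesEquiv_symm_holds _ P]
    exact hF1' hf' P hPN' (h23 _)
  rw [hl, hl', ← Int.cast_mul, hprod] at h0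
  exact_mod_cast h0

end Main

end Summit.BirchSwinnertonDyer.BirchSwinnertonDyer.Theorems.AdditiveKoly.RamifiedHabitat

end
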